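import Summits.ABC.ABC.Theses.IsogenyGlueCongruence
import Summits.ABC.ABC.Theorems.IsogenyGlueCongruencePolyAbcOfPolyDegree
import Summits.ABC.ABC.Theorems.SharpDegreeOfPolyDegree.Negative.ExponentFloor
import Literature.NumberTheory.DiophantineGeometry.PastenValuationProducts
import Literature.NumberTheory.DiophantineGeometry.MinimalDiscriminantNormProofs

set_option linter.dupNamespace false

/-!
# Crux `SharpDegreeOfPolyDegree` (stmt-ABC-10895), line `Sketch`: valuation bounds under Poly

`R := SharpDegreeOfPolyDegree = (Poly → X)`, `Poly` = the polynomial modular-degree bound for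
semistable curves (the antecedent of the route decl, inlined below verbatim).  This support file
(lands `--supports stmt-ABC-10895`) proves the two consequences of `Poly` that the line
`oldforms-free-under-poly` (crux dir `Cruxes/SharpDegreeOfPolyDegree/Lines/Sketch.lean`) uses:

* `polySzpiro_of_polyDegree` — Poly ⟹ polynomial Szpiro `|Δ_min(E)| ≤ A' · N_E^m` for EVERY
  semistable elliptic `E/ℚ` (from the landed `Summit.ABC.ABC.Theorems.polySzpiroSemistable_of_polyDegree`
  on a global minimal model, `…Negative.exists_globallyMinimal_model`).
* `stub_valuationLogBound` (L0, the registered stub of the line's skeleton, verbatim) — Poly ⟹ `v_p(Δ_min(E)) · log p ≤ A log N_E + A` for every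
  prime `p` and every semistable `E/ℚ`: each exponent of the minimal discriminant is `O(log N)`.
  This is the input that makes the Ribet–Takahashi factor `v_q(Δ_min)` in Takahashi's degree formula
  harmless in the line's reduction.
* `valuationProduct_le_of_polyDegree` (L1, flatness) — Poly ⟹ `T(E) = ∏_{p ∣ N} v_p(Δ_min(E)) ≤ C_ε N^ε`
  for every semistable `E/ℚ` (`Literature.NumberTheory.DiophantineGeometry.valuationProduct`): the
  semistable case of route RibetTakahashiSplit's `Many/FewPrimeValuationProduct` follows from the
  antecedent of `R`.  Elementary from polynomial Szpiro: split the primes of `N` at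
  `L = ⌈e^{2m/ε}⌉ + 3`; small primes contribute `≤ (K₁ N^δ)^{L+1}`, large ones `≤ (∏ p^{v_p})^{1/log L}
  ≤ (A' N^m)^{1/log L}`.

Theorems only (no definition, no named fact); Poly is a hypothesis everywhere, `R` itself is not
touched here.
-/

noncomputable section

namespace Summit.ABC.ABC.Theorems.SharpDegreeOfPolyDegree

open Summit.ABC.ABC.Theses.IsogenyGlueCongruence
open Literature.NumberTheory.EllipticCurves Literature.NumberTheory.EllipticCurves.ModularForms
open Literature.NumberTheory.DiophantineGeometry
open WeierstrassCurve

/-! ## Poly ⟹ polynomial Szpiro ⟹ (L0) -/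

/-- **Poly ⟹ polynomial Szpiro** for every semistable `E/ℚ`: under the polynomial modular-degree
bound there are `m ≥ 0`, `A'` with `|Δ_min(E)| ≤ A' · N_E^m` (via a global minimal model and the
landed `polySzpiroSemistable_of_polyDegree`: Zagier's identity, Pasten's trivial Petersson bound,
Silverman's covolume inequality). [cite: PastenShimura2024, §3] -/
theorem polySzpiro_of_polyDegree
    (hPoly : ∃ κ C : ℝ, ∀ (W : WeierstrassCurve ℚ) [W.IsElliptic] [W.IsGloballyMinimal]
      [NeZero (W.conductorNorm ℤ)], W.IsSemistable ℤ →
        ∃ D : ModularParametrizationData W (W.conductorNorm ℤ),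
          (D.modularDegree : ℝ) ≤ C * (W.conductorNorm ℤ : ℝ) ^ κ) :
    ∃ m A' : ℝ, 0 ≤ m ∧ ∀ (W : WeierstrassCurve ℚ) [W.IsElliptic], W.IsSemistable ℤ →
      (W.minimalDiscriminantNorm ℤ : ℝ) ≤ A' * (W.conductorNorm ℤ : ℝ) ^ m := by
  obtain ⟨K, C, h⟩ := Summit.ABC.ABC.Theorems.polySzpiroSemistable_of_polyDegree hPoly
  refine ⟨max K 0, max C 0, le_max_right _ _, fun W _ hss => ?_⟩
  obtain ⟨W₁, hE₁, hM₁, hss₁, hN₁, hΔ₁⟩ := Negative.exists_globallyMinimal_model W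
  haveI := hE₁
  haveI := hM₁
  have hNpos : 0 < W₁.conductorNorm ℤ := conductorNorm_pos_holds W₁
  haveI : NeZero (W₁.conductorNorm ℤ) := ⟨hNpos.ne'⟩
  have h1 := h W₁ (hss₁ hss)
  have hN1 : (1 : ℝ) ≤ (W₁.conductorNorm ℤ : ℝ) := by exact_mod_cast hNpos
  have hN0 : (0 : ℝ) ≤ (W₁.conductorNorm ℤ : ℝ) := by linarith
  calc (W.minimalDiscriminantNorm ℤ : ℝ) = ((|W₁.Δ| : ℚ) : ℝ) := hΔ₁.symm
    _ ≤ ((max |W₁.Δ| (|W₁.c₄| ^ 3) : ℚ) : ℝ) := Rat.cast_le.mpr (le_max_left _ _)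
    _ ≤ C * (W₁.conductorNorm ℤ : ℝ) ^ K := h1
    _ ≤ max C 0 * (W₁.conductorNorm ℤ : ℝ) ^ K :=
        mul_le_mul_of_nonneg_right (le_max_left _ _) (Real.rpow_nonneg hN0 _)
    _ ≤ max C 0 * (W₁.conductorNorm ℤ : ℝ) ^ (max K 0) :=
        mul_le_mul_of_nonneg_left (Real.rpow_le_rpow_of_exponent_le hN1 (le_max_left _ _))
          (le_max_right _ _)
    _ = max C 0 * (W.conductorNorm ℤ : ℝ) ^ (max K 0) := by rw [hN₁]

/-- Single valuation: `v_p(n) · log p ≤ log n` for `n ≠ 0`. [folklore] -/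
theorem factorization_mul_log_le {n : ℕ} (hn : n ≠ 0) {p : ℕ} (hp : p.Prime) :
    ((n.factorization p : ℕ) : ℝ) * Real.log p ≤ Real.log n := by
  have hdvd : p ^ n.factorization p ∣ n := Nat.ordProj_dvd _ _
  have hle : (p : ℝ) ^ n.factorization p ≤ (n : ℝ) := by
    exact_mod_cast Nat.le_of_dvd (Nat.pos_of_ne_zero hn) hdvd
  have hp0 : (0 : ℝ) < p := by exact_mod_cast hp.pos
  rw [← Real.log_pow]
  exact Real.log_le_log (pow_pos hp0 _) hle

/-- **(L0) Single-valuation bound under Poly** — the registered stub `stub_valuationLogBound` of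
the line's skeleton (`Cruxes/SharpDegreeOfPolyDegree/Lines/Sketch.lean`), verbatim: there is `A`
with `v_p(Δ_min(E)) · log p ≤ A · log N_E + A` for every semistable elliptic `E/ℚ` and every prime
`p` (from `polySzpiro_of_polyDegree`: `v_p log p ≤ log |Δ_min| ≤ log A' + m log N`). [folklore] -/
theorem stub_valuationLogBound :
    (∃ κ C : ℝ, ∀ (W : WeierstrassCurve ℚ) [W.IsElliptic] [W.IsGloballyMinimal]
      [NeZero (W.conductorNorm ℤ)], W.IsSemistable ℤ →
        ∃ D : ModularParametrizationData W (W.conductorNorm ℤ),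
          (D.modularDegree : ℝ) ≤ C * (W.conductorNorm ℤ : ℝ) ^ κ) →
    ∃ A : ℝ, ∀ (W : WeierstrassCurve ℚ) [W.IsElliptic], W.IsSemistable ℤ → ∀ p : ℕ, p.Prime →
      (((W.minimalDiscriminantNorm ℤ).factorization p : ℕ) : ℝ) * Real.log p ≤
        A * Real.log (W.conductorNorm ℤ) + A := by
  intro hPoly
  obtain ⟨m, A', hm, h⟩ := polySzpiro_of_polyDegree hPoly
  refine ⟨max (Real.log (max A' 1)) m, fun W _ hss p hp => ?_⟩
  have hΔpos : 0 < W.minimalDiscriminantNorm ℤ := minimalDiscriminantNorm_pos_holds W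
  have hNpos : 0 < W.conductorNorm ℤ := conductorNorm_pos_holds W
  have hN1 : (1 : ℝ) ≤ (W.conductorNorm ℤ : ℝ) := by exact_mod_cast hNpos
  have hlogN : 0 ≤ Real.log (W.conductorNorm ℤ : ℝ) := Real.log_nonneg hN1
  have h1 := factorization_mul_log_le hΔpos.ne' hp
    (n := W.minimalDiscriminantNorm ℤ)
  have hA1 : 1 ≤ max A' 1 := le_max_right _ _
  have h2 : (W.minimalDiscriminantNorm ℤ : ℝ) ≤ max A' 1 * (W.conductorNorm ℤ : ℝ) ^ m :=
    (h W hss).trans (mul_le_mul_of_nonneg_right (le_max_left _ _) (Real.rpow_nonneg (by linarith) _))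
  have hΔr : (0 : ℝ) < (W.minimalDiscriminantNorm ℤ : ℝ) := by exact_mod_cast hΔpos
  have h3 : Real.log (W.minimalDiscriminantNorm ℤ : ℝ) ≤
      Real.log (max A' 1) + m * Real.log (W.conductorNorm ℤ : ℝ) := by
    calc Real.log (W.minimalDiscriminantNorm ℤ : ℝ)
          ≤ Real.log (max A' 1 * (W.conductorNorm ℤ : ℝ) ^ m) := Real.log_le_log hΔr h2
      _ = Real.log (max A' 1) + m * Real.log (W.conductorNorm ℤ : ℝ) := by
          rw [Real.log_mul (ne_of_gt (lt_of_lt_of_le one_pos hA1))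
            (ne_of_gt (Real.rpow_pos_of_pos (by linarith) _)), Real.log_rpow (by linarith)]
  calc (((W.minimalDiscriminantNorm ℤ).factorization p : ℕ) : ℝ) * Real.log p
        ≤ Real.log (max A' 1) + m * Real.log (W.conductorNorm ℤ : ℝ) := h1.trans h3
    _ ≤ max (Real.log (max A' 1)) m +
          max (Real.log (max A' 1)) m * Real.log (W.conductorNorm ℤ : ℝ) :=
        add_le_add (le_max_left _ _) (mul_le_mul_of_nonneg_right (le_max_right _ _) hlogN)
    _ = max (Real.log (max A' 1)) m * Real.log (W.conductorNorm ℤ) +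
          max (Real.log (max A' 1)) m := by
        ring

/-! ## (L1) Flatness under Poly -/

/-- For any finite set `T` of primes, `∏_{p ∈ T} p^{v_p(n)} ≤ n` (`n ≠ 0`). [folklore] -/
theorem prod_pow_factorization_le {n : ℕ} (hn : n ≠ 0) (T : Finset ℕ)
    (hT : ∀ p ∈ T, p.Prime) : ∏ p ∈ T, p ^ n.factorization p ≤ n := by
  classical
  have h1 : ∏ p ∈ T, p ^ n.factorization p ≤ ∏ p ∈ T ∪ n.primeFactors, p ^ n.factorization p := by
    apply Finset.prod_le_prod_of_subset_of_one_le' Finset.subset_union_left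
    intro p hp _
    have hp' : p.Prime := by
      rcases Finset.mem_union.mp hp with h | h
      · exact hT p h
      · exact Nat.prime_of_mem_primeFactors h
    exact Nat.one_le_pow _ _ hp'.pos
  have h2 : ∏ p ∈ T ∪ n.primeFactors, p ^ n.factorization p =
      ∏ p ∈ n.primeFactors, p ^ n.factorization p := by
    symm
    apply Finset.prod_subset Finset.subset_union_right
    intro p _ hpn
    have : n.factorization p = 0 := by
      rw [← Nat.support_factorization] at hpn
      exact Finsupp.notMem_support_iff.mp hpn
    rw [this, pow_zero]
  have h3 : ∏ p ∈ n.primeFactors, p ^ n.factorization p = n := by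
    conv_rhs => rw [← Nat.prod_factorization_pow_eq_self hn]
    rw [Finsupp.prod, Nat.support_factorization]
  calc ∏ p ∈ T, p ^ n.factorization p ≤ ∏ p ∈ T ∪ n.primeFactors, p ^ n.factorization p := h1
    _ = n := by rw [h2, h3]

/-- Real form: `∏_{p ∈ T} (p : ℝ)^{v_p(n)} ≤ n`. [folklore] -/
theorem prod_rpow_factorization_le {n : ℕ} (hn : n ≠ 0) (T : Finset ℕ)
    (hT : ∀ p ∈ T, p.Prime) : ∏ p ∈ T, ((p : ℝ) ^ (n.factorization p : ℕ)) ≤ (n : ℝ) := by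
  have := prod_pow_factorization_le hn T hT
  exact_mod_cast this

/-- **(L1) Flatness under Poly**: the polynomial modular-degree bound for semistable curves implies
`T(E) = ∏_{p ∣ N_E} v_p(Δ_min(E)) ≤ C_ε · N_E^ε` for every semistable elliptic `E/ℚ` and every
`ε > 0` — the Ribet–Takahashi factor is negligible under the antecedent of `R` (the semistable case
of route RibetTakahashiSplit's `Many/FewPrimeValuationProduct`).  From `polySzpiro_of_polyDegree`
(`|Δ_min| ≤ A' N^m`): primes `p ≤ L := ⌈e^{2m/ε}⌉ + 3` have `v_p ≤ (log A' + m log N)/log 2 ≤ K₁ N^δ`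
with `δ (L+1) = ε/2`; primes `p > L` have `v_p ≤ (p^{v_p})^{1/log L}` and `∏ p^{v_p} ≤ |Δ_min|`,
`m / log L ≤ ε/2`. [folklore] -/
theorem valuationProduct_le_of_polyDegree
    (hPoly : ∃ κ C : ℝ, ∀ (W : WeierstrassCurve ℚ) [W.IsElliptic] [W.IsGloballyMinimal]
      [NeZero (W.conductorNorm ℤ)], W.IsSemistable ℤ →
        ∃ D : ModularParametrizationData W (W.conductorNorm ℤ),
          (D.modularDegree : ℝ) ≤ C * (W.conductorNorm ℤ : ℝ) ^ κ) :
    ∀ ε : ℝ, 0 < ε → ∃ C : ℝ, ∀ (W : WeierstrassCurve ℚ) [W.IsElliptic], W.IsSemistable ℤ →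
      (valuationProduct W : ℝ) ≤ C * (W.conductorNorm ℤ : ℝ) ^ ε := by
  intro ε hε
  obtain ⟨m, A', hm, hSz⟩ := polySzpiro_of_polyDegree hPoly
  -- parameters
  set L : ℕ := ⌈Real.exp (2 * m / ε)⌉₊ + 3 with hLdef
  have hL3 : (3 : ℝ) ≤ L := by
    have : 3 ≤ L := by omega
    exact_mod_cast this
  have hLexp : Real.exp (2 * m / ε) ≤ L := by
    have h1 : Real.exp (2 * m / ε) ≤ ⌈Real.exp (2 * m / ε)⌉₊ := Nat.le_ceil _
    have h2 : (⌈Real.exp (2 * m / ε)⌉₊ : ℝ) ≤ L := by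
      rw [hLdef]; push_cast; linarith
    linarith
  have hlogL : 1 ≤ Real.log L := by
    rw [Real.le_log_iff_exp_le (by linarith)]
    have := Real.exp_one_lt_d9; linarith
  have hlogL0 : 0 < Real.log L := by linarith
  set θ : ℝ := 1 / Real.log L with hθ
  have hθ0 : 0 < θ := by positivity
  have hθL : θ * Real.log L = 1 := by rw [hθ]; field_simp
  have hmθ : m * θ ≤ ε / 2 := by
    have h1 : 2 * m / ε ≤ Real.log L := by
      have := Real.log_le_log (Real.exp_pos _) hLexp
      rwa [Real.log_exp] at this
    rw [hθ]
    rw [mul_one_div, div_le_iff₀ hlogL0]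
    calc m = (2 * m / ε) * (ε / 2) := by field_simp
      _ ≤ Real.log L * (ε / 2) := mul_le_mul_of_nonneg_right h1 (by linarith)
      _ = ε / 2 * Real.log L := by ring
  set δ : ℝ := ε / (2 * ((L : ℝ) + 1)) with hδ
  have hδ0 : 0 < δ := by positivity
  have hδL : δ * ((L : ℝ) + 1) = ε / 2 := by rw [hδ]; field_simp
  set B : ℝ := Real.log (max A' 1) with hB
  have hB0 : 0 ≤ B := Real.log_nonneg (le_max_right _ _)
  have hlog2 : 0 < Real.log 2 := Real.log_pos (by norm_num)
  set K₁ : ℝ := 1 + B / Real.log 2 + m / (δ * Real.log 2) with hK₁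
  have hK₁1 : 1 ≤ K₁ := by
    rw [hK₁]
    have : 0 ≤ B / Real.log 2 := by positivity
    have : 0 ≤ m / (δ * Real.log 2) := by positivity
    linarith
  have hA1 : 1 ≤ max A' 1 := le_max_right _ _
  refine ⟨K₁ ^ (L + 1) * (max A' 1) ^ θ, ?_⟩
  intro W _ hss
  -- basic facts about N and Δ
  have hNpos : 0 < W.conductorNorm ℤ := conductorNorm_pos_holds W
  have hN1 : (1 : ℝ) ≤ (W.conductorNorm ℤ : ℝ) := by exact_mod_cast hNpos
  have hN0 : (0 : ℝ) < (W.conductorNorm ℤ : ℝ) := by linarith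
  have hΔpos : 0 < W.minimalDiscriminantNorm ℤ := minimalDiscriminantNorm_pos_holds W
  have hΔ0 : W.minimalDiscriminantNorm ℤ ≠ 0 := hΔpos.ne'
  have hΔr : (0 : ℝ) < (W.minimalDiscriminantNorm ℤ : ℝ) := by exact_mod_cast hΔpos
  have hΔle : (W.minimalDiscriminantNorm ℤ : ℝ) ≤ max A' 1 * (W.conductorNorm ℤ : ℝ) ^ m :=
    (hSz W hss).trans (mul_le_mul_of_nonneg_right (le_max_left _ _) (Real.rpow_nonneg hN0.le _))
  have hlogΔ : Real.log (W.minimalDiscriminantNorm ℤ : ℝ) ≤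
      B + m * Real.log (W.conductorNorm ℤ : ℝ) := by
    have hpos : 0 < max A' 1 * (W.conductorNorm ℤ : ℝ) ^ m :=
      mul_pos (lt_of_lt_of_le one_pos hA1) (Real.rpow_pos_of_pos hN0 _)
    calc Real.log (W.minimalDiscriminantNorm ℤ : ℝ)
          ≤ Real.log (max A' 1 * (W.conductorNorm ℤ : ℝ) ^ m) := Real.log_le_log hΔr hΔle
      _ = B + m * Real.log (W.conductorNorm ℤ : ℝ) := by
          rw [hB, Real.log_mul (ne_of_gt (lt_of_lt_of_le one_pos hA1))
            (ne_of_gt (Real.rpow_pos_of_pos hN0 _)), Real.log_rpow hN0]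
  have hlogN : 0 ≤ Real.log (W.conductorNorm ℤ : ℝ) := Real.log_nonneg hN1
  have hlogNδ : Real.log (W.conductorNorm ℤ : ℝ) ≤ (W.conductorNorm ℤ : ℝ) ^ δ / δ :=
    Real.log_le_rpow_div hN0.le hδ0
  have hNδ1 : 1 ≤ (W.conductorNorm ℤ : ℝ) ^ δ := Real.one_le_rpow hN1 hδ0.le
  -- split the product
  classical
  set S := (W.conductorNorm ℤ).primeFactors with hS
  set v : ℕ → ℕ := fun p => (W.minimalDiscriminantNorm ℤ).factorization p with hv
  have hsplit : (valuationProduct W : ℝ) =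
      (∏ p ∈ S.filter (fun p => p ≤ L), (v p : ℝ)) *
        (∏ p ∈ S.filter (fun p => ¬ p ≤ L), (v p : ℝ)) := by
    rw [valuationProduct_def, ← Finset.prod_filter_mul_prod_filter_not S (fun p => p ≤ L)]
    push_cast
    rfl
  -- pointwise bound on every valuation
  have hvle : ∀ p ∈ S, (v p : ℝ) ≤ (B + m * Real.log (W.conductorNorm ℤ : ℝ)) / Real.log 2 := by
    intro p hp
    have hpp : p.Prime := Nat.prime_of_mem_primeFactors hp
    have h1 := factorization_mul_log_le hΔ0 hpp
    have hlogp : Real.log 2 ≤ Real.log p :=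
      Real.log_le_log (by norm_num) (by exact_mod_cast hpp.two_le)
    rw [le_div_iff₀ hlog2]
    calc (v p : ℝ) * Real.log 2 ≤ (v p : ℝ) * Real.log p :=
          mul_le_mul_of_nonneg_left hlogp (Nat.cast_nonneg _)
      _ ≤ Real.log (W.minimalDiscriminantNorm ℤ : ℝ) := h1
      _ ≤ B + m * Real.log (W.conductorNorm ℤ : ℝ) := hlogΔ
  -- (A) small primes
  have hV : (B + m * Real.log (W.conductorNorm ℤ : ℝ)) / Real.log 2 ≤
      K₁ * (W.conductorNorm ℤ : ℝ) ^ δ := by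
    rw [div_le_iff₀ hlog2, hK₁]
    have h1 : m * Real.log (W.conductorNorm ℤ : ℝ) ≤ m * ((W.conductorNorm ℤ : ℝ) ^ δ / δ) :=
      mul_le_mul_of_nonneg_left hlogNδ hm
    have h2 : B ≤ B * (W.conductorNorm ℤ : ℝ) ^ δ := le_mul_of_one_le_right hB0 hNδ1
    have h3 : 0 ≤ (W.conductorNorm ℤ : ℝ) ^ δ := by linarith
    have h4 : (1 + B / Real.log 2 + m / (δ * Real.log 2)) * (W.conductorNorm ℤ : ℝ) ^ δ * Real.log 2
        = Real.log 2 * (W.conductorNorm ℤ : ℝ) ^ δ + B * (W.conductorNorm ℤ : ℝ) ^ δ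
          + m * ((W.conductorNorm ℤ : ℝ) ^ δ / δ) := by
      field_simp
    rw [h4]
    nlinarith [mul_nonneg hlog2.le h3]
  have hA_ : ∏ p ∈ S.filter (fun p => p ≤ L), (v p : ℝ) ≤
      K₁ ^ (L + 1) * (W.conductorNorm ℤ : ℝ) ^ (ε / 2) := by
    have hcard : (S.filter (fun p => p ≤ L)).card ≤ L + 1 := by
      calc (S.filter (fun p => p ≤ L)).card ≤ (Finset.range (L + 1)).card := by
            apply Finset.card_le_card
            intro p hp
            rw [Finset.mem_filter] at hp
            exact Finset.mem_range.mpr (Nat.lt_succ_of_le hp.2)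
        _ = L + 1 := Finset.card_range _
    have hX1 : 1 ≤ K₁ * (W.conductorNorm ℤ : ℝ) ^ δ := by nlinarith
    calc ∏ p ∈ S.filter (fun p => p ≤ L), (v p : ℝ)
          ≤ ∏ p ∈ S.filter (fun p => p ≤ L), (K₁ * (W.conductorNorm ℤ : ℝ) ^ δ) := by
            apply Finset.prod_le_prod (fun p _ => Nat.cast_nonneg _)
            intro p hp
            exact ((hvle p (Finset.mem_filter.mp hp).1).trans hV)
      _ = (K₁ * (W.conductorNorm ℤ : ℝ) ^ δ) ^ (S.filter (fun p => p ≤ L)).card :=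
            Finset.prod_const _
      _ ≤ (K₁ * (W.conductorNorm ℤ : ℝ) ^ δ) ^ (L + 1) := pow_le_pow_right₀ hX1 hcard
      _ = K₁ ^ (L + 1) * ((W.conductorNorm ℤ : ℝ) ^ δ) ^ (L + 1) := mul_pow _ _ _
      _ = K₁ ^ (L + 1) * (W.conductorNorm ℤ : ℝ) ^ (ε / 2) := by
            congr 1
            rw [← Real.rpow_natCast, ← Real.rpow_mul hN0.le]
            congr 1
            push_cast
            linarith [hδL]
  -- (B) large primes
  have hB_ : ∏ p ∈ S.filter (fun p => ¬ p ≤ L), (v p : ℝ) ≤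
      (max A' 1) ^ θ * (W.conductorNorm ℤ : ℝ) ^ (ε / 2) := by
    have hprime : ∀ p ∈ S.filter (fun p => ¬ p ≤ L), p.Prime :=
      fun p hp => Nat.prime_of_mem_primeFactors (Finset.mem_filter.mp hp).1
    -- v_p ≤ (p^{v_p})^θ for p > L
    have hpt : ∀ p ∈ S.filter (fun p => ¬ p ≤ L), (v p : ℝ) ≤ ((p : ℝ) ^ (v p : ℕ)) ^ θ := by
      intro p hp
      have hpL : (L : ℝ) < p := by
        have := (Finset.mem_filter.mp hp).2
        push Not at this
        exact_mod_cast this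
      have hp0 : (0 : ℝ) < p := by linarith
      have hlogp : Real.log L ≤ Real.log p := Real.log_le_log (by linarith) hpL.le
      have h1 : (v p : ℝ) ≤ (v p : ℝ) * (θ * Real.log p) := by
        have : 1 ≤ θ * Real.log p := by
          calc (1 : ℝ) = θ * Real.log L := hθL.symm
            _ ≤ θ * Real.log p := mul_le_mul_of_nonneg_left hlogp hθ0.le
        exact le_mul_of_one_le_right (Nat.cast_nonneg _) this
      calc (v p : ℝ) ≤ (v p : ℝ) * (θ * Real.log p) := h1
        _ ≤ (v p : ℝ) * (θ * Real.log p) + 1 := by linarith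
        _ ≤ Real.exp ((v p : ℝ) * (θ * Real.log p)) := Real.add_one_le_exp _
        _ = ((p : ℝ) ^ (v p : ℕ)) ^ θ := by
            rw [← Real.rpow_natCast, ← Real.rpow_mul hp0.le, Real.rpow_def_of_pos hp0]
            congr 1; ring
    have hnonneg : ∀ p ∈ S.filter (fun p => ¬ p ≤ L), (0 : ℝ) ≤ (p : ℝ) ^ (v p : ℕ) :=
      fun p _ => pow_nonneg (Nat.cast_nonneg _) _
    calc ∏ p ∈ S.filter (fun p => ¬ p ≤ L), (v p : ℝ)
          ≤ ∏ p ∈ S.filter (fun p => ¬ p ≤ L), ((p : ℝ) ^ (v p : ℕ)) ^ θ :=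
            Finset.prod_le_prod (fun p _ => Nat.cast_nonneg _) hpt
      _ = (∏ p ∈ S.filter (fun p => ¬ p ≤ L), (p : ℝ) ^ (v p : ℕ)) ^ θ :=
            Real.finsetProd_rpow _ _ hnonneg θ
      _ ≤ ((W.minimalDiscriminantNorm ℤ : ℕ) : ℝ) ^ θ :=
            Real.rpow_le_rpow (Finset.prod_nonneg hnonneg)
              (prod_rpow_factorization_le hΔ0 _ hprime) hθ0.le
      _ ≤ (max A' 1 * (W.conductorNorm ℤ : ℝ) ^ m) ^ θ :=
            Real.rpow_le_rpow hΔr.le hΔle hθ0.le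
      _ = (max A' 1) ^ θ * (W.conductorNorm ℤ : ℝ) ^ (m * θ) := by
            rw [Real.mul_rpow (by linarith) (Real.rpow_nonneg hN0.le _), ← Real.rpow_mul hN0.le]
      _ ≤ (max A' 1) ^ θ * (W.conductorNorm ℤ : ℝ) ^ (ε / 2) :=
            mul_le_mul_of_nonneg_left (Real.rpow_le_rpow_of_exponent_le hN1 hmθ)
              (Real.rpow_nonneg (by linarith) _)
  -- combine
  have hA0 : 0 ≤ ∏ p ∈ S.filter (fun p => p ≤ L), (v p : ℝ) :=
    Finset.prod_nonneg (fun p _ => Nat.cast_nonneg _)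
  have hB0' : 0 ≤ ∏ p ∈ S.filter (fun p => ¬ p ≤ L), (v p : ℝ) :=
    Finset.prod_nonneg (fun p _ => Nat.cast_nonneg _)
  rw [hsplit]
  calc (∏ p ∈ S.filter (fun p => p ≤ L), (v p : ℝ)) *
        (∏ p ∈ S.filter (fun p => ¬ p ≤ L), (v p : ℝ))
        ≤ (K₁ ^ (L + 1) * (W.conductorNorm ℤ : ℝ) ^ (ε / 2)) *
          ((max A' 1) ^ θ * (W.conductorNorm ℤ : ℝ) ^ (ε / 2)) :=
          mul_le_mul hA_ hB_ hB0' (by positivity)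
    _ = K₁ ^ (L + 1) * (max A' 1) ^ θ *
          ((W.conductorNorm ℤ : ℝ) ^ (ε / 2) * (W.conductorNorm ℤ : ℝ) ^ (ε / 2)) := by ring
    _ = K₁ ^ (L + 1) * (max A' 1) ^ θ * (W.conductorNorm ℤ : ℝ) ^ ε := by
          rw [← Real.rpow_add hN0]; ring_nf

end Summit.ABC.ABC.Theorems.SharpDegreeOfPolyDegree

end
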